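import Summits.NavierStokesRegularity.FluidComputer.BlockRegulationGate

/-!
# Fourier-block instance — §11 OPEN WINDOWS (1/2): the upper readout window is inessential;
# half-open windows, their statics, the open residue and the summit corollary

HONEST FRAMING. Low prior, high value-of-information experiment on Tao's machine paradigm; NOT a
claim that NS blows up. Nothing in this file is evidence about Navier–Stokes: it re-types the
READOUT WINDOWS of the Fourier-block design (plane geometry and real arithmetic only).

WHAT `BlockRegulation` / `BlockRegulationGate` SHOWED. With the block design's windows
`Acore = [aLo, aHi] × [−c0, c0]`, `Aout = [−σsp, σsp] × [aLo, aHi]` every circuit inhabiting `dat`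
must REGULATE (`withholding_law`, `conservative_needs_spent`, `regGate_dat`); both laws come from
the UPPER window `aHi` (an output amplitude may not exceed `aHi − δsh` although an input may be
`aHi + δ`).

WHAT THIS FILE SHOWS. The upper window is INESSENTIAL to the architecture: `aHi` enters no budget
of `Params` (`next_output`, `erasure`), and `Literature…FluidComputer.ShadowedCircuit` asks nothing
of `Ain`/`Acore`/`Aout` beyond `core_thick`, `handoff`, `floor_cert`, `dat`, `seed_read` — all of
which hold verbatim for the HALF-OPEN windows

  `AcoreO = [aLo, ∞) × [−c0, c0]`, `AinO` = its open `δ`-neighbourhood, `AoutO = [−σsp, σsp] × [aLo, ∞)`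

(`core_thickO`, `handoffO`, `floor_certO`, `seed_readO`; same proofs as `BlockReadout.core_thick`,
`BlockHandoff.handoff`, `BlockReadout.floor_cert`, `BlockStatics.seed_read`), and then
`OpenCircuitClock P` / `OpenIdeaBound 𝒟 P C` / `OpenCircuitClock.toShadowedCircuit` /
`ns_blowup_of_openIdeaBound`: the open-window residue refutes Clay (A) exactly as the bounded one
does (`BlockBlowup.ns_blowup_of_blockDynamics`). The ENERGY side — the passive bound survives
(`eta_le_of_passiveO`), the energy-CONSERVING quarter turn inhabits the open `dat`
(`conservative_datO`), the `Params.reg` instance `openRegCircuitClock` and the closed-form residue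
`ns_blowup_of_openRegIdeaBound` — is the sequel `BlockOpenGate` (split off for the 400-line cap).

PRICE OF THE OPEN WINDOW (honest). (i) `OpenIdeaBound` quantifies over loaded states of EVERY
amplitude `a > aLo − δ` at each generation (a one-parameter scale family per generation) — more
states than `IdeaBound`, though each is asked LESS (no regulation). (ii) `H10Control` (a UNIFORM
`H¹⁰` bound over the circuit tube) fails as typed for the unbounded open tube; liveness of the open
design uses the per-orbit refinement of `BlockOpenLive` instead; `ns_blowup` / `stableBlowup` do
not use it. `OpenIdeaBound` is IDEA-BOUND and, for the bare two-wavelet design, PRESUMABLY FALSE.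
-/

noncomputable section

open MeasureTheory Set Filter Topology Metric
open scoped ENNReal NNReal SchwartzMap

namespace Summit.NavierStokesRegularity.FluidComputer

open Literature.Analysis.FluidPDE Literature.Analysis.FluidPDE.Tao2016
open Literature.Analysis.FluidPDE.FluidComputer
open Summit.NavierStokesRegularity.NavierStokesRegularity.Theorems.FluidComputer

namespace BlockDesign

/-! ## Half-open windows and their statics -/

section Windows

variable (𝒟 : CascadeWaveletData 1 1) {S : CascadeSpecs} (P : Params S)

/-- Open loaded core: input amplitude `≥ aLo` (no upper window), output amplitude `≤ c0`. [folklore] -/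
def AcoreO : Set (ℝ × ℝ) := Set.Ici P.aLo ×ˢ Set.Icc (-P.c0) P.c0

/-- Open admissible inputs: the open `δ`-neighbourhood of the open core. [folklore] -/
def AinO : Set (ℝ × ℝ) := {q | ∃ p ∈ AcoreO P, dist q p < P.δ}

/-- Open outputs: input amplitude spent (`≤ σsp`), output amplitude `≥ aLo`. [folklore] -/
def AoutO : Set (ℝ × ℝ) := Set.Icc (-P.σsp) P.σsp ×ˢ Set.Ici P.aLo

variable {P}

/-- `Acore ⊆ AcoreO`. [folklore] -/
theorem Acore_subset_AcoreO : Acore P ⊆ AcoreO P := by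
  rintro p ⟨⟨h1, -⟩, h2⟩
  exact ⟨h1, h2⟩

/-- `Ain ⊆ AinO`. [folklore] -/
theorem Ain_subset_AinO : Ain P ⊆ AinO P := by
  rintro q ⟨p, hp, hd⟩
  exact ⟨p, Acore_subset_AcoreO hp, hd⟩

/-- `Aout ⊆ AoutO`. [folklore] -/
theorem Aout_subset_AoutO : Aout P ⊆ AoutO P := by
  rintro p ⟨h1, ⟨h2, -⟩⟩
  exact ⟨h1, h2⟩

/-- `core_thick` for the open windows. [folklore] -/
theorem core_thickO (p : ℝ × ℝ) (hp : p ∈ AcoreO P) : Metric.ball p P.δ ⊆ AinO P :=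
  fun q hq => ⟨p, hp, by rwa [Metric.mem_ball] at hq⟩

/-- Coordinates of `AinO`: `aLo − δ < a` and `|b| < c0 + δ`. [folklore] -/
theorem AinO_bounds {q : ℝ × ℝ} (hq : q ∈ AinO P) : P.aLo - P.δ < q.1 ∧ |q.2| < P.c0 + P.δ := by
  obtain ⟨p, hp, hd⟩ := hq
  have hp' : P.aLo ≤ p.1 ∧ (-P.c0 ≤ p.2 ∧ p.2 ≤ P.c0) := by
    simpa only [AcoreO, Set.mem_prod, Set.mem_Ici, Set.mem_Icc] using hp
  rw [Prod.dist_eq, Real.dist_eq, Real.dist_eq] at hd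
  have h1 := abs_lt.1 (lt_of_le_of_lt (le_max_left _ _) hd)
  have h2 := abs_lt.1 (lt_of_le_of_lt (le_max_right _ _) hd)
  exact ⟨by linarith [h1.1], abs_lt.2 ⟨by linarith [h2.1], by linarith [h2.2]⟩⟩

/-- A state read in `AinO` has input amplitude `> 1`. [folklore] -/
theorem one_lt_of_mem_AinO {q : ℝ × ℝ} (hq : q ∈ AinO P) : 1 < q.1 := by
  have h := (AinO_bounds hq).1
  linarith [P.one_le]

/-- `(a, 0) ∈ AinO` for `aLo − δ < a`. [folklore] -/
theorem mem_AinO_base {a : ℝ} (h1 : P.aLo - P.δ < a) : (a, (0 : ℝ)) ∈ AinO P := by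
  refine ⟨(max a P.aLo, 0), ⟨Set.mem_Ici.2 (le_max_right a P.aLo), ⟨by simpa using P.c0_nonneg, P.c0_nonneg⟩⟩, ?_⟩
  rw [Prod.dist_eq, Real.dist_eq, Real.dist_eq, sub_self, abs_zero]
  refine max_lt ?_ P.δ_pos
  rcases le_or_gt P.aLo a with h | h
  · rw [max_eq_left h, sub_self, abs_zero]; exact P.δ_pos
  · rw [max_eq_right h.le, abs_of_neg (by linarith)]; linarith

variable {𝒟}

/-- `floor_cert` for the open windows: a state read in `AinO` carries energy `≥ E_n` at frequencies
`|ξ| ≥ λ_n`. [folklore] -/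
theorem floor_certO (n : ℕ) (v : L2C) (hv : read 𝒟 S n v ∈ AinO P) :
    ENNReal.ofReal (S.Emin n) ≤ highFreqEnergy (S.lam n) v := by
  rw [P.lam_eq]
  have hE := sqrt_Emin_pos S n
  have h1 : 1 < (coef 𝒟 n v).re / Real.sqrt (S.Emin n) := one_lt_of_mem_AinO hv
  have h2 : Real.sqrt (S.Emin n) < ‖coef 𝒟 n v‖ := by
    rw [lt_div_iff₀ hE, one_mul] at h1
    exact h1.trans_le ((le_abs_self _).trans (Complex.abs_re_le_norm _))
  have h3 : S.Emin n ≤ ‖coef 𝒟 n v‖ ^ 2 := by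
    rw [← Real.sq_sqrt (S.Emin_pos n).le]
    exact pow_le_pow_left₀ hE.le h2.le 2
  calc ENNReal.ofReal (S.Emin n) ≤ ENNReal.ofReal (‖coef 𝒟 n v‖ ^ 2) := ENNReal.ofReal_le_ofReal h3
    _ = ‖coef 𝒟 n v‖ₑ ^ 2 := by rw [ENNReal.ofReal_pow (norm_nonneg _), ofReal_norm]
    _ ≤ highFreqEnergy ((2 : ℝ) ^ n) v := enorm_coef_sq_le_highFreqEnergy n v

/-- **Hand-off for the open windows** (the proof of `BlockHandoff.handoff` uses only `|a_n| ≤ σsp`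
and `a_{n+1} ≥ aLo`). [folklore] -/
theorem handoffO (n : ℕ) (v : L2C) (hv : read 𝒟 S n v ∈ AoutO P)
    (hj : junk 𝒟 P n v ≤ ENNReal.ofReal (P.jrun * Real.sqrt (S.Emin n))) :
    read 𝒟 S (n + 1) v ∈ AcoreO P ∧
      junk 𝒟 P (n + 1) v ≤ ENNReal.ofReal (P.jcore * Real.sqrt (S.Emin (n + 1))) := by
  have hE := sqrt_Emin_pos S n
  have h4 : (0 : ℝ) < (4 : ℝ) ^ P.s := Real.rpow_pos_of_pos (by norm_num) _
  obtain ⟨h1, h2⟩ := hv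
  -- the spent input amplitude
  have hσ : |(coef 𝒟 n v).re| ≤ P.σsp * Real.sqrt (S.Emin n) := by
    have h := abs_le.2 ⟨h1.1, h1.2⟩
    change |(coef 𝒟 n v).re / Real.sqrt (S.Emin n)| ≤ P.σsp at h
    rwa [abs_div, abs_of_pos hE, div_le_iff₀ hE] at h
  refine ⟨⟨h2, ?_⟩, ?_⟩
  · -- new output coordinate: `|Re⟨v,ψ_{n+2}⟩| / √E_{n+2} ≤ jrun / (4^s η) ≤ c0`
    have key : |(coef 𝒟 (n + 2) v).re / Real.sqrt (S.Emin (n + 2))| ≤ P.c0 := by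
      have hE2 := sqrt_Emin_pos S (n + 2)
      rw [abs_div, abs_of_pos hE2, div_le_iff₀ hE2, sqrt_Emin_succ_succ]
      have hc := norm_coef_add_two_le (𝒟 := 𝒟) (P := P) n v hj
      calc |(coef 𝒟 (n + 2) v).re| ≤ ‖coef 𝒟 (n + 2) v‖ := Complex.abs_re_le_norm _
        _ ≤ P.jrun * Real.sqrt (S.Emin n) / (4 : ℝ) ^ P.s := by
            rw [le_div_iff₀ h4, mul_comm]; exact hc
        _ ≤ P.c0 * S.eta * (4 : ℝ) ^ P.s * Real.sqrt (S.Emin n) / (4 : ℝ) ^ P.s :=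
            div_le_div_of_nonneg_right (mul_le_mul_of_nonneg_right P.next_output hE.le) h4.le
        _ = P.c0 * (S.eta * Real.sqrt (S.Emin n)) := by field_simp
    exact abs_le.1 key
  · -- new junk: `inf` over the old design states of the spent-block bookkeeping, then `erasure`
    set K : ℝ≥0∞ := ENNReal.ofReal ((1 / 2 : ℝ) ^ P.s) + ENNReal.ofReal ((3 / 4 : ℝ) ^ P.s) with hK
    set L : ℝ≥0∞ := ENNReal.ofReal (P.σsp * Real.sqrt (S.Emin n)) * ENNReal.ofReal ((3 / 4 : ℝ) ^ P.s)
      with hL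
    have h12 : (0 : ℝ) < (1 / 2 : ℝ) ^ P.s := Real.rpow_pos_of_pos (by norm_num) _
    have h34 : (0 : ℝ) < (3 / 4 : ℝ) ^ P.s := Real.rpow_pos_of_pos (by norm_num) _
    have hσ0 : 0 ≤ P.σsp * Real.sqrt (S.Emin n) := (abs_nonneg _).trans hσ
    have hK0 : K ≠ 0 := by
      rw [hK]; exact ne_of_gt (lt_of_lt_of_le (ENNReal.ofReal_pos.2 h12) le_self_add)
    have hKtop : K ≠ ⊤ := ENNReal.add_ne_top.2 ⟨ENNReal.ofReal_ne_top, ENNReal.ofReal_ne_top⟩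
    calc junk 𝒟 P (n + 1) v ≤ ⨅ p : ℝ × ℝ, (K * J P.μ (S.lam n) P.s (v - recon 𝒟 S n p) + L) :=
          le_iInf fun p => junk_succ_le_of_design n v hσ p
      _ = K * junk 𝒟 P n v + L := by
          rw [junk, ENNReal.mul_iInf_of_ne hK0 hKtop, ENNReal.iInf_add]
      _ ≤ K * ENNReal.ofReal (P.jrun * Real.sqrt (S.Emin n)) + L := by gcongr
      _ = ENNReal.ofReal ((((1 / 2 : ℝ) ^ P.s + (3 / 4 : ℝ) ^ P.s) * P.jrun +
            (3 / 4 : ℝ) ^ P.s * P.σsp) * Real.sqrt (S.Emin n)) := by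
          rw [hK, hL, ← ENNReal.ofReal_add h12.le h34.le, ← ENNReal.ofReal_mul (add_pos h12 h34).le,
            ← ENNReal.ofReal_mul hσ0,
            ← ENNReal.ofReal_add (mul_nonneg (add_pos h12 h34).le (mul_nonneg P.jrun_pos.le hE.le))
              (mul_nonneg hσ0 h34.le)]
          congr 1; ring
      _ ≤ ENNReal.ofReal (P.jcore * Real.sqrt (S.Emin (n + 1))) := by
          refine ENNReal.ofReal_le_ofReal ?_
          rw [sqrt_Emin_succ, ← mul_assoc]
          exact mul_le_mul_of_nonneg_right P.erasure hE.le

variable (𝒟 P)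

/-- The seed reads `(aLo, 0) ∈ AcoreO` at block `0`. [folklore] -/
theorem seed_readO : read 𝒟 S 0 (schwartzL2 (seed 𝒟 P)) ∈ AcoreO P :=
  Acore_subset_AcoreO (seed_read 𝒟 P)

end Windows

/-! ## The open-window residue and the summit corollary -/

section Residue

variable (𝒟 : CascadeWaveletData 1 1) {S : CascadeSpecs} (P : Params S)

/-- `Dat` for the open windows: every open-admissible input reaches, within rescaled time `τc`, a
point whose closed `δsh`-ball lies in the open output region. [folklore] -/
def DatO (Φ : ℝ → ℝ × ℝ → ℝ × ℝ) (τc δsh : ℝ) : Prop :=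
  ∀ p ∈ AinO P, ∃ σ : ℝ, 0 ≤ σ ∧ σ ≤ τc ∧ Metric.closedBall (Φ σ p) δsh ⊆ AoutO P

/-- `ε`-passivity on the open input region. [folklore] -/
def PassiveO (Φ : ℝ → ℝ × ℝ → ℝ × ℝ) (τc ε : ℝ) : Prop :=
  ∀ p ∈ AinO P, ∀ σ : ℝ, 0 ≤ σ → σ ≤ τc → pairEnergy S.eta (Φ σ p) ≤ pairEnergy S.eta p + ε

/-- The CIRCUIT+CLOCK half over the open windows. Design-level; inhabited below, conservatively.
[folklore] -/
structure OpenCircuitClock where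
  /-- the gate, in rescaled time -/
  Φ : ℝ → ℝ × ℝ → ℝ × ℝ
  /-- rescaled cycle time -/
  τc : ℝ
  τc_nonneg : 0 ≤ τc
  /-- shadowing margin -/
  δsh : ℝ
  δsh_nonneg : 0 ≤ δsh
  /-- delayed abrupt transition with margin, open windows -/
  dat : DatO P Φ τc δsh
  /-- physical time per unit rescaled time at generation `n` -/
  unit : ℕ → ℝ
  unit_pos : ∀ n, 0 < unit n
  clock : ∀ n, unit n * τc ≤ S.Tmax n

/-- The IDEA-BOUND half over the open windows: every `H¹⁰_df`-mild Navier–Stokes trajectory read in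
`AinO` (ANY input amplitude `> aLo − δ`) with loaded junk shadows `C.Φ` within `C.δsh` for one cycle
while its weighted junk stays below the running threshold. Presumably FALSE for the two-wavelet
design; nothing here asserts it. [folklore] -/
structure OpenIdeaBound (C : OpenCircuitClock P) : Prop where
  /-- shadowing -/
  shadow : ∀ (n : ℕ) (a : L2C) (S' : ℝ) (u : ℝ → L2C), IsMildSolutionFor eulerForm a (Ico 0 S') u →
    ∀ t : ℝ, 0 ≤ t → read 𝒟 S n (u t) ∈ AinO P →
      junk 𝒟 P n (u t) ≤ ENNReal.ofReal (P.jin * Real.sqrt (S.Emin n)) →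
      ∀ σ : ℝ, 0 ≤ σ → σ ≤ C.τc → t + C.unit n * σ < S' →
        dist (read 𝒟 S n (u (t + C.unit n * σ))) (C.Φ σ (read 𝒟 S n (u t))) ≤ C.δsh
  /-- leakage -/
  leak : ∀ (n : ℕ) (a : L2C) (S' : ℝ) (u : ℝ → L2C), IsMildSolutionFor eulerForm a (Ico 0 S') u →
    ∀ t : ℝ, 0 ≤ t → read 𝒟 S n (u t) ∈ AinO P →
      junk 𝒟 P n (u t) ≤ ENNReal.ofReal (P.jin * Real.sqrt (S.Emin n)) →
      ∀ σ : ℝ, 0 ≤ σ → σ ≤ C.τc → t + C.unit n * σ < S' →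
        junk 𝒟 P n (u (t + C.unit n * σ)) ≤ ENNReal.ofReal (P.jrun * Real.sqrt (S.Emin n))

variable {𝒟 P}

/-- **The open-window design assembled**: an open circuit+clock with its idea-bound half IS a shadowed
circuit design over `S` (observable space `ℝ × ℝ`, junk exponent `s`). [folklore] -/
def OpenCircuitClock.toShadowedCircuit (C : OpenCircuitClock P) (H : OpenIdeaBound 𝒟 P C) :
    ShadowedCircuit S (ℝ × ℝ) P.s where
  read := read 𝒟 S
  recon := recon 𝒟 S
  junk := junk 𝒟 P
  Λ := (Real.sqrt S.eta)⁻¹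
  Λ_pos := inv_pos.2 (Real.sqrt_pos.2 S.eta_pos)
  read_lip := fun n v w => read_lip n v w
  junk_perturb := fun n v w => junk_perturb n v w
  read_recon := fun n p => read_recon n p
  junk_recon := fun n p => junk_recon n p
  Ain := AinO P
  Acore := AcoreO P
  Aout := AoutO P
  δ := P.δ
  δ_pos := P.δ_pos
  core_thick := fun p hp => core_thickO p hp
  jcore := P.jcore
  jin := P.jin
  jrun := P.jrun
  jcore_nonneg := P.jcore_nonneg
  jcore_lt := P.jcore_lt_jin
  handoff := fun n v hv hj => handoffO n v hv hj
  floor_cert := fun n v hv _ => floor_certO n v hv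
  Φ := C.Φ
  τc := C.τc
  τc_nonneg := C.τc_nonneg
  δsh := C.δsh
  δsh_nonneg := C.δsh_nonneg
  dat := C.dat
  unit := C.unit
  unit_pos := C.unit_pos
  clock := C.clock
  shadow := H.shadow
  leak := H.leak
  u₀ := seed 𝒟 P
  divFree := seed_divFree 𝒟 P
  memH10df := seed_memH10df 𝒟 P
  seed_read := seed_readO 𝒟 P
  seed_junk := seed_junk 𝒟 P

/-- **The open-window residue refutes Clay (A)** (`α > 0`, `η > 1/4`). HONEST FRAMING: an implication
from a structure not known (and not believed) to be inhabited; NOT a claim that NS blows up. -/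
theorem ns_blowup_of_openIdeaBound (C : OpenCircuitClock P) (H : OpenIdeaBound 𝒟 P C)
    (hα : 0 < S.alpha) (hη : 1 / 4 < S.eta) : ¬ NavierStokesRegularity :=
  ns_blowup_of_shadowedCircuit (C.toShadowedCircuit H) hα hη

end Residue

end BlockDesign

end Summit.NavierStokesRegularity.FluidComputer

end
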